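import Literature.NumberTheory.Automorphic.HilbertModularGaloisRepAnalyticProofs
import Literature.NumberTheory.Automorphic.PairLFunctionPolesRepDataHolds
import HarnessLib

/-!
# Galois representations of Hilbert modular eigenforms: Ribet's irreducibility argument with
# Jacquet–Shalika (2.1) discharged, and on the `L²` leaves of (2.2)–(2.3) (proofs only)

Topic `Literature/NumberTheory/Automorphic`; namespace `Literature.NumberTheory.Automorphic`.
Third PROOFS file (theorems only: no definition, no named fact, no instance, no `sorry`) for the
named fact `galoisRep_GL2_totallyReal_irreducible` of `HilbertModularGaloisRep` (Ribet; Skinner,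
Doc. Math. 14 (2009), §2.4.2 and the Remark on p. 257: "If `ρ_π ≅ χ₁ ⊕ χ₂`, then each `χ_i` is
potentially semistable and hence is the Galois representation associated to an algebraic Hecke
character `ψ_i` of `F` … It then follows that `L(π ⊗ ψ₂⁻¹, s - 1/2) = L(ψ₁/ψ₂, s) ζ_F(s)` … this
implies that `L(π ⊗ ψ₂⁻¹, s)` has a pole at `s = 1`, contradicting the cuspidality of `π`"), after
`HilbertModularGaloisRepProofs` (the algebra: stable line, semisimplification, Satake-level
compatibility, `E`-rationality from the Hecke eigenvalues) and
`HilbertModularGaloisRepAnalyticProofs` (the analytic half from Jacquet–Shalika (2.1)–(2.3) for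
Borel–Jacquet data, `…_of_JS`).

Of the three Jacquet–Shalika inputs of `…_of_JS`, (2.1)
(`JacquetShalika1981_multipliable_partialPairL_repData`: absolute convergence of `L^S(s, π ⊗ σ)` on
`Re s > 1`) is now a theorem of the tree (`JacquetShalika1981_multipliable_partialPairL_repData_holds`
of `PairLFunctionPolesRepDataHolds`, from Jacquet–Shalika I, Thm. (5.3) in the `L²` model and the
Borel–Jacquet dictionary leaves), and (2.2), (2.3) for Borel–Jacquet data are theorems **modulo their
`L²` leaves** (`JacquetShalika1981_partialPairL_boundary_repData_of_L2_leaves`,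
`JacquetShalika1981_partialPairL_pole_repData_of_pole_of_eq_conj`).  This file records the
consequences for the fact:

* `not_eventually_satake_eq_heckePair_of_JS'`, `not_nearlyEisenstein_GL2_totallyReal_of_JS'` — the
  analytic half ("a cuspidal `π` on `GL₂(𝔸_F)` is not nearly equivalent to
  `χ₁|·|^{1/2} ⊞ χ₂|·|^{1/2}`") from (2.2) and (2.3) for Borel–Jacquet data alone;
* `galoisRep_GL2_totallyReal_irreducible_of_abelianSummandIsHecke_of_JS'` — the fact from the
  dictionary input ("abelian summands of `ρ_π` are Hecke") and (2.2), (2.3);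
* `galoisRep_GL2_totallyReal_irreducible_of_weaklyDivides_of_heckeEigenvalue_mem_of_JS'` — the fact
  from Böckle–Hui Thm. 1.1 (`GaloisRepresentations.exists_heckeCharacter_of_weaklyDivides`), the
  rationality of the unramified Hecke eigenvalues of `π` (Shimura 1978; Clozel 1990, Thm. 3.13;
  Böckle–Hui §3.1) and (2.2), (2.3) — **four hypotheses, three of them named facts of the tree**;
* `galoisRep_GL2_totallyReal_irreducible_of_weaklyDivides_of_heckeEigenvalue_mem_of_L2_leaves` — the
  same with (2.2), (2.3) replaced by their `L²` leaves
  (`JacquetShalika1981_partialPairL_at_one_of_ne_conj`, `…_boundary_of_ne_one`,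
  `…_at_one_of_rank_ne`, `multiplicity_one_gl`, `JacquetShalika1981_partialPairL_pole_of_eq_conj` of
  `PairLFunctionPoles` / `AutomorphicGLn`), i.e. the fact on the tree's primitive named facts.

When these are discharged, `galoisRep_GL2_totallyReal_irreducible_holds` is the last theorem applied
to their proofs.  Nothing here restates or weakens a named fact; no definition, instance or named
fact is added (D-0026).

## References

* C. M. Skinner, *A note on the `p`-adic Galois representations attached to Hilbert modular
  forms*, Doc. Math. 14 (2009), 241–258, §2.4.2 and Remark p. 257. [Skinner2009]
* G. Böckle, C. Y. Hui, *Weak abelian direct summands and irreducibility of Galois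
  representations*, arXiv:2404.08954 (2025), Thm. 1.1, §3.1, §3.2.1. [BockleHui2025]
* J. Arthur, L. Clozel, *Simple algebras, base change, and the advanced theory of the trace
  formula*, Ann. of Math. Stud. 120 (1989), Ch. 3 §2, (2.1)–(2.3), p. 171. [ArthurClozelAMS120]
* H. Jacquet, J. A. Shalika, *On Euler products and the classification of automorphic
  representations I, II*, Amer. J. Math. 103 (1981), 499–558 and 777–815: I Thm. (5.3); II Prop. 3.6,
  Thm. 4.4. [JacquetShalikaAJM1981] [JacquetShalikaAJM1981II]
* L. Clozel, *Motifs et formes automorphes*, in Automorphic forms, Shimura varieties, and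
  L-functions I (Ann Arbor 1988), Academic Press 1990, Thm. 3.13. [Clozel1990]
-/

noncomputable section

open scoped MatrixGroups Topology Classical
open NumberField IsDedekindDomain MeasureTheory Filter Polynomial

namespace Literature.NumberTheory.Automorphic

open AdelicGroupData
open Literature.NumberTheory.GaloisRepresentations (HeckeCharacter)

/-! ### The analytic half with (2.1) discharged -/

section Core

variable {F : Type} [Field F] [NumberField F]

/-- **A cuspidal automorphic representation of `GL₂(𝔸_F)` is not nearly equivalent to
`χ₁|·|^{1/2} ⊞ χ₂|·|^{1/2}`, from (2.2) and (2.3) for Borel–Jacquet data**: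
`not_eventually_satake_eq_heckePair_of_JS` with its hypothesis (2.1) supplied by the theorem
`JacquetShalika1981_multipliable_partialPairL_repData_holds`.
[cite: JacquetShalikaAJM1981II, Thm. 4.4] [cite: Skinner2009, §2.4.2 Remark (p. 257)]
[cite: ArthurClozelAMS120, Ch. 3 §2 (2.2)–(2.3)] -/
theorem not_eventually_satake_eq_heckePair_of_JS'
    (hJ2 : JacquetShalika1981_partialPairL_boundary_repData)
    (hJ3 : JacquetShalika1981_partialPairL_pole_repData)
    {hcpt : isCompact_glFiniteIntegralLevel 2 F}
    (π : CuspidalAutomorphicRepData 2 F hcpt) (χ₁ χ₂ : HeckeCharacter F) :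
    ¬ ∀ᶠ v : HeightOneSpectrum (𝓞 F) in cofinite,
        ∀ α : Multiset ℂ, π.1.HasSatakeParamAt v α →
          α.map (fun a => (((Real.sqrt (v.residueCard : ℝ)) : ℝ) : ℂ) * a) =
            ({χ₁.valueAtUniformizer v, χ₂.valueAtUniformizer v} : Multiset ℂ) :=
  not_eventually_satake_eq_heckePair_of_JS
    JacquetShalika1981_multipliable_partialPairL_repData_holds hJ2 hJ3 π χ₁ χ₂

end Core

/-! ### Assembly with (2.1) discharged -/

section Assembly

/-- **The analytic half `hJS` of `HilbertModularGaloisRepProofs` from (2.2) and (2.3) for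
Borel–Jacquet data** ((2.1) being the theorem
`JacquetShalika1981_multipliable_partialPairL_repData_holds`).
[cite: JacquetShalikaAJM1981II, Thm. 4.4] [cite: Skinner2009, §2.4.2 Remark (p. 257)] -/
theorem not_nearlyEisenstein_GL2_totallyReal_of_JS'
    (hJ2 : JacquetShalika1981_partialPairL_boundary_repData)
    (hJ3 : JacquetShalika1981_partialPairL_pole_repData) :
    ∀ {K : Type} [Field K] [NumberField K] (hcpt : isCompact_glFiniteIntegralLevel 2 K),
      IsTotallyReal K → ∀ (π : CuspidalAutomorphicRepData 2 K hcpt), π.1.IsRegularAlgebraic →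
      ∀ (χ₁ χ₂ : HeckeCharacter K), χ₁.IsAlgebraic → χ₂.IsAlgebraic →
      ¬ ∀ᶠ v : HeightOneSpectrum (𝓞 K) in cofinite,
          χ₁.IsUnramifiedAt v ∧ χ₂.IsUnramifiedAt v ∧
          ∀ α : Multiset ℂ, π.1.HasSatakeParamAt v α →
            α.map (fun a => (((Real.sqrt (v.residueCard : ℝ)) : ℝ) : ℂ) * a) =
              ({χ₁.valueAtUniformizer v, χ₂.valueAtUniformizer v} : Multiset ℂ) :=
  not_nearlyEisenstein_GL2_totallyReal_of_JS
    JacquetShalika1981_multipliable_partialPairL_repData_holds hJ2 hJ3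

/-- **The fact from the dictionary input and Jacquet–Shalika (2.2), (2.3) for Borel–Jacquet data**:
`galoisRep_GL2_totallyReal_irreducible_of_abelianSummandIsHecke_of_JS` with (2.1) discharged; the
remaining hypothesis `hdict` is the `n = 2`, totally real case of "abelian summands of `ρ_π` are
Hecke" (Hodge–Tate + Serre III §2.3–2.4 in print; Böckle–Hui Thm. 1.1 + `E`-rationality in the tree).
[cite: Skinner2009, §2.4.2 Remark (p. 257)] [cite: ArthurClozelAMS120, Ch. 3 §2 (2.2)–(2.3)] -/
theorem galoisRep_GL2_totallyReal_irreducible_of_abelianSummandIsHecke_of_JS'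
    (hdict : ∀ {K : Type} [Field K] [NumberField K] (hcpt : isCompact_glFiniteIntegralLevel 2 K),
      IsTotallyReal K → ∀ (π : CuspidalAutomorphicRepData 2 K hcpt), π.1.IsRegularAlgebraic →
      ∀ (ℓ : ℕ) [Fact ℓ.Prime] (ι : PadicAlgCl ℓ ≃+* ℂ)
        (r : GaloisRepresentations.FramedGaloisRep K (PadicAlgCl ℓ) 2),
      r.toGaloisRep.IsSemisimple →
      (∀ (v : HeightOneSpectrum (𝓞 K)) (α : Multiset ℂ), π.1.HasSatakeParamAt v α →
          ((ℓ : ℕ) : 𝓞 K) ∉ v.asIdeal →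
            r.IsUnramifiedAt v ∧ r.HasFrobCharpolyAt v (arithFrobPolyOfSatake ι v.residueCard 2 α)) →
      ∀ (τ : GaloisRepresentations.FramedGaloisRep K (PadicAlgCl ℓ) 1),
      (∃ x : Fin 2 → PadicAlgCl ℓ, x ≠ 0 ∧ ∀ g : Field.absoluteGaloisGroup K,
          r.toGaloisRep g x =
            ((Matrix.GeneralLinearGroup.det (τ g) : (PadicAlgCl ℓ)ˣ) : PadicAlgCl ℓ) • x) →
      ∃ χ : HeckeCharacter K, χ.IsAlgebraic ∧
        ∀ᶠ v : HeightOneSpectrum (𝓞 K) in cofinite, χ.IsUnramifiedAt v ∧ τ.IsUnramifiedAt v ∧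
          τ.HasFrobCharpolyAt v (X - C (ι.symm (χ.valueAtUniformizer v)⁻¹)))
    (hJ2 : JacquetShalika1981_partialPairL_boundary_repData)
    (hJ3 : JacquetShalika1981_partialPairL_pole_repData) :
    galoisRep_GL2_totallyReal_irreducible :=
  galoisRep_GL2_totallyReal_irreducible_of_abelianSummandIsHecke_of_JS hdict
    JacquetShalika1981_multipliable_partialPairL_repData_holds hJ2 hJ3

/-- **The fact from Böckle–Hui Thm. 1.1, the rationality of the Hecke eigenvalues of `π`, and
Jacquet–Shalika (2.2), (2.3) for Borel–Jacquet data** —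
`galoisRep_GL2_totallyReal_irreducible_of_weaklyDivides_of_heckeEigenvalue_mem_of_JS` with (2.1)
discharged by `JacquetShalika1981_multipliable_partialPairL_repData_holds`.  Of the four hypotheses
three are named facts of the tree (`GaloisRepresentations.exists_heckeCharacter_of_weaklyDivides`,
`JacquetShalika1981_partialPairL_boundary_repData`, `JacquetShalika1981_partialPairL_pole_repData`);
`hShi` is the printed statement "the unramified Hecke eigenvalues `t_{v,1}, t_{v,2}` of a regular
algebraic cuspidal `π` on `GL₂` over a totally real field lie in a number field `E ⊆ ℂ`" (Shimura
1978; Clozel 1990, Thm. 3.13; Böckle–Hui §3.1).  When these are discharged,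
`galoisRep_GL2_totallyReal_irreducible_holds` is this theorem applied to their proofs.
[cite: Skinner2009, §2.4.2 Remark (p. 257)] [cite: BockleHui2025, Theorem 1.1, §3.1 and §3.2.1]
[cite: ArthurClozelAMS120, Ch. 3 §2 (2.2)–(2.3)] -/
theorem galoisRep_GL2_totallyReal_irreducible_of_weaklyDivides_of_heckeEigenvalue_mem_of_JS'
    (hBH : GaloisRepresentations.exists_heckeCharacter_of_weaklyDivides)
    (hShi : ∀ {K : Type} [Field K] [NumberField K] (hcpt : isCompact_glFiniteIntegralLevel 2 K),
      IsTotallyReal K → ∀ (π : CuspidalAutomorphicRepData 2 K hcpt), π.1.IsRegularAlgebraic →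
      ∃ E : Subfield ℂ, FiniteDimensional ℚ E ∧
        ∀ᶠ v : HeightOneSpectrum (𝓞 K) in cofinite, ∀ α : Multiset ℂ,
          π.1.HasSatakeParamAt v α → ∀ i ≤ 2, heckeEigenvalueOf 2 v α i ∈ E)
    (hJ2 : JacquetShalika1981_partialPairL_boundary_repData)
    (hJ3 : JacquetShalika1981_partialPairL_pole_repData) :
    galoisRep_GL2_totallyReal_irreducible :=
  galoisRep_GL2_totallyReal_irreducible_of_weaklyDivides_of_heckeEigenvalue_mem_of_JS hBH hShi
    JacquetShalika1981_multipliable_partialPairL_repData_holds hJ2 hJ3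

/-- **The same, with the eigenvalue rationality in the general shape (a') used across the tree**
(`HeckeStabilizerRatFieldProofs`, `Patrikis2019_cmDescent_of_clozel_of_heckeEigenvalue_mem`): for
every cuspidal regular algebraic `π` on every `GL_n(𝔸_K)` the unramified Hecke eigenvalues at almost
all places lie in a subfield of `ℂ` finite over `ℚ` (Clozel 1990, Thm. 3.13: `π_f` is defined over the
number field `ℚ(π_f)`); only its case `n = 2`, `K` totally real is used.
[cite: Skinner2009, §2.4.2 Remark (p. 257)] [cite: Clozel1990, Thm. 3.13]
[cite: BockleHui2025, Theorem 1.1, §3.1 and §3.2.1] -/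
theorem galoisRep_GL2_totallyReal_irreducible_of_weaklyDivides_of_heckeEigenvalue_mem_all_of_JS'
    (hBH : GaloisRepresentations.exists_heckeCharacter_of_weaklyDivides)
    (hrat : ∀ (n : ℕ) (K : Type) [Field K] [NumberField K]
      (hcpt : isCompact_glFiniteIntegralLevel n K) (π : CuspidalAutomorphicRepData n K hcpt),
      π.1.IsRegularAlgebraic →
        ∃ E : Subfield ℂ, FiniteDimensional ℚ E ∧
          ∀ᶠ v : HeightOneSpectrum (𝓞 K) in cofinite, ∀ α : Multiset ℂ,
            π.1.HasSatakeParamAt v α → ∀ i ≤ n, heckeEigenvalueOf n v α i ∈ E)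
    (hJ2 : JacquetShalika1981_partialPairL_boundary_repData)
    (hJ3 : JacquetShalika1981_partialPairL_pole_repData) :
    galoisRep_GL2_totallyReal_irreducible :=
  galoisRep_GL2_totallyReal_irreducible_of_weaklyDivides_of_heckeEigenvalue_mem_of_JS' hBH
    (fun hcpt _ π hπ => hrat 2 _ hcpt π hπ) hJ2 hJ3

/-- **The fact on the tree's primitive named facts**: Böckle–Hui Thm. 1.1, the rationality of the
Hecke eigenvalues of `π`, and the `L²` leaves of Jacquet–Shalika (2.2), (2.3) —
`JacquetShalika1981_partialPairL_at_one_of_ne_conj`, `…_boundary_of_ne_one`, `…_at_one_of_rank_ne`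
(Jacquet–Shalika II, Prop. 3.6 off `X`; non-vanishing on `Re s = 1`: Shahidi) with
`multiplicity_one_gl`, and `JacquetShalika1981_partialPairL_pole_of_eq_conj` (Jacquet–Shalika II,
Prop. 3.6: the simple pole of `L^S(s, π ⊗ π̃)` at `s = 1`), each granted for all `GL_n` over all
number fields and all automorphic measures — through
`JacquetShalika1981_partialPairL_boundary_repData_of_L2_leaves` and
`JacquetShalika1981_partialPairL_pole_repData_of_pole_of_eq_conj` (the Borel–Jacquet dictionary leaves
being theorems). [cite: Skinner2009, §2.4.2 Remark (p. 257)]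
[cite: BockleHui2025, Theorem 1.1, §3.1 and §3.2.1] [cite: ArthurClozelAMS120, Ch. 3 §2 (2.2)–(2.3)]
[cite: JacquetShalikaAJM1981II, Prop. 3.6 and Thm. 4.4] -/
theorem galoisRep_GL2_totallyReal_irreducible_of_weaklyDivides_of_heckeEigenvalue_mem_of_L2_leaves
    (hBH : GaloisRepresentations.exists_heckeCharacter_of_weaklyDivides)
    (hShi : ∀ {K : Type} [Field K] [NumberField K] (hcpt : isCompact_glFiniteIntegralLevel 2 K),
      IsTotallyReal K → ∀ (π : CuspidalAutomorphicRepData 2 K hcpt), π.1.IsRegularAlgebraic →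
      ∃ E : Subfield ℂ, FiniteDimensional ℚ E ∧
        ∀ᶠ v : HeightOneSpectrum (𝓞 K) in cofinite, ∀ α : Multiset ℂ,
          π.1.HasSatakeParamAt v α → ∀ i ≤ 2, heckeEigenvalueOf 2 v α i ∈ E)
    (h22 : ∀ {n : ℕ} {K : Type} [Field K] [NumberField K] {μ : Measure (gl n K).automorphicQuotient}
      [(gl n K).IsAutomorphicMeasure μ],
      JacquetShalika1981_partialPairL_at_one_of_ne_conj (n := n) (K := K) (μ := μ))
    (h22' : ∀ {n m : ℕ} {K : Type} [Field K] [NumberField K]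
      {μ : Measure (gl n K).automorphicQuotient} [(gl n K).IsAutomorphicMeasure μ]
      {μ' : Measure (gl m K).automorphicQuotient} [(gl m K).IsAutomorphicMeasure μ'],
      JacquetShalika1981_partialPairL_boundary_of_ne_one (n := n) (m := m) (K := K) (μ := μ)
        (μ' := μ'))
    (hrk : ∀ {n m : ℕ} {K : Type} [Field K] [NumberField K]
      {μ : Measure (gl n K).automorphicQuotient} [(gl n K).IsAutomorphicMeasure μ]
      {μ' : Measure (gl m K).automorphicQuotient} [(gl m K).IsAutomorphicMeasure μ'],
      JacquetShalika1981_partialPairL_at_one_of_rank_ne (n := n) (m := m) (K := K) (μ := μ)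
        (μ' := μ'))
    (hm1 : ∀ (n : ℕ) (K : Type) [Field K] [NumberField K] (μ : Measure (gl n K).automorphicQuotient)
      [(gl n K).IsAutomorphicMeasure μ], multiplicity_one_gl n K μ)
    (h23 : ∀ {n : ℕ} {K : Type} [Field K] [NumberField K] {μ : Measure (gl n K).automorphicQuotient}
      [(gl n K).IsAutomorphicMeasure μ],
      JacquetShalika1981_partialPairL_pole_of_eq_conj (n := n) (K := K) (μ := μ)) :
    galoisRep_GL2_totallyReal_irreducible :=
  galoisRep_GL2_totallyReal_irreducible_of_weaklyDivides_of_heckeEigenvalue_mem_of_JS' hBH hShi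
    (JacquetShalika1981_partialPairL_boundary_repData_of_L2_leaves h22 h22' hrk hm1)
    (JacquetShalika1981_partialPairL_pole_repData_of_pole_of_eq_conj h23)

end Assembly

end Literature.NumberTheory.Automorphic

end
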